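import Mathlib
import Summits.KontsevichZagierPeriods.Zeta5Search.BrickHoleFamilies
import Summits.KontsevichZagierPeriods.Zeta5Search.BrickDigitStripCirc

/-!
# BrickHoleStrip — zi-p2's THEOREM 10 (i) «HOLE = HAT»: for a HOLE cell `K = K₀ + K'p` (`N₀ < K₀ < p`) of the row
`N = N₀ + (m+1)p` of either brick kernel, `F_K^{(N)}(pT) = a·F̃_{K'}^{(m)}(T)·Ê_{K'}(T)·Q^{cl}(T)·U_K(T)` with the
CLASS POLYNOMIAL `Q^{cl} = (T − (K'+m+2))^{Bε₁}(T + (2m+2−K'))^{Bε₂}(T + y_c)^{ε·c_c}` (cell zeta5-irr)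

HONEST FRAMING: systematic search; no irrationality claim unless certified. INSTRUMENT lemma of the ζ(5)
census cell zeta5-irr (HOME `run/shared/lean/pub/zeta5-irr/`; memo `zi-p2/probes/B8/thm10/THEOREM10.md` (sealed
eeb9a92811d678e0) §1 «Q^{cl}(t′) := (t′ − n − 1)^{Bε₁}·(t′ + 2n)^{Bε₂}·(t′ + (n−1)/2)^{c}, K^{cl}_n := Q^{cl}·R̂_n =
Q^{cl}·P·R̃_{n−1}», §2 «(i) HOLE = HAT (no level hypothesis). For every row (♮, N) with N ≥ p and every hole cell K of
class cl = (ε₁, ε₂, c): F_K^{(N)}(pT) = Λ_K·F^{cl}_{K′}(T)·U_K(T)», LEMMA 10.1). Here `n = m + 1`, the classes are the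
carries `ε₁ = (N₀ + K₀)/p` (`= [K₀ + N₀ ≥ p]`), `ε₂ = (N₀ + (N₀ + p − K₀))/p` (`= [K₀ ≤ 2N₀]`), and the centre
class is `ε·c_c` with `c_c = BrickDigitStripCirc.centreCarry` (`[p ∣ N − 2K]`, i.e. `2K₀ = N₀ + p` for a hole cell),
the centre member being written `y_c = (N/2 − K)/p` (`= m/2 − K'` in that case). THEOREM 9 (i) (`BrickHatStrip`,
`N₀ = 0`) is the trivial class. Nothing here is about ζ(5); no irrationality content; filing moves no rung. Filed by the
engine seat zi-eng (g10); assembly as in `BrickHatStrip`/`BrickDigitStripCirc` on `BrickHoleFamilies`.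

## The statements (`p` odd prime, `ε ≤ 1`, `N₀ < K₀ < p`, `K' ≤ m`; `N = N₀ + (m+1)p`, `K = K₀ + K'p`)

* `classPoly B ε p N₀ m K₀ K'` (zi-p2's `Q^{cl}(−K'+T)`), `holePoly = hatPoly·classPoly`; `isSlopeInt_classPoly`,
  `isSlopeInt_holePoly` (`ℤ_(p)` coefficients);
* `num_comp_eq_hole`, **`laurentSeries_rescale_eq_hole`**: `rescale_p(laurentSeries A B ε N K) = C(a)·laurentSeries A B 0 m K'
  ·holePoly·U` with `U(0) = 1`, `IsSlopeInt p (−1) 0 U`, and `a·holePoly(0)·laurent A B 0 m K' 0 = laurent A B ε N K 0`.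
The valuation of `a` (`A + B|ε| + c` plus that of `n^{A−2B}`, LEMMA 10.2) is the sequel file.
-/

namespace Summit.KontsevichZagierPeriods.Zeta5Search.BrickHoleStrip

open Finset Nat Polynomial WithZero
open Summit.KontsevichZagierPeriods.Zeta5Search.BrickLaurent (expandAt laurentSeries laurent kerNum kerDenErase
  constantCoeff_coe_taylor coe_comp_C_mul_X rescale_inv eval_kerDenErase_neg_ne_zero)
open Summit.KontsevichZagierPeriods.Zeta5Search.BrickLaurentValuation (taylor_kerNum taylor_kerDenErase)
open Summit.KontsevichZagierPeriods.Zeta5Search.ScaledSeries (IsSlopeInt isSlopeInt_mul isSlopeInt_pow isSlopeInt_one)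
open Summit.KontsevichZagierPeriods.Zeta5Search.BrickPhiCoeff (isSlopeInt_inv)
open Summit.KontsevichZagierPeriods.Zeta5Search.BrickDigitStrip (IsUnitPoly)
open Summit.KontsevichZagierPeriods.Zeta5Search.BrickDigitStripCarry (prod_Icc_add_of_le_one padicValuation_centre_le)
open Summit.KontsevichZagierPeriods.Zeta5Search.BrickDigitStripCirc (centreCarry centreCarry_le_one centre_factor_circ
  isSlopeInt_X_add_C)
open Summit.KontsevichZagierPeriods.Zeta5Search.BrickHatStrip (hatPoly isSlopeInt_hatPoly)
open Summit.KontsevichZagierPeriods.Zeta5Search.BrickHoleFamilies (hole_carry_le_one den_family_hole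
  num_family_one_hole num_family_two_hole)
open Literature.NumberTheory.LFunctions (padicValuation_natCast_le_one)

noncomputable section

variable {p : ℕ} [Fact p.Prime]

/-! ## The class polynomial -/

/-- **zi-p2's CLASS POLYNOMIAL at `−K'`**: `Q^{cl}(−K'+X) = (X − (K'+m+2))^{Bε₁}·(X + (2m+2−K'))^{Bε₂}·(X + y_c)^{ε c_c}`
for the hole cell `K = K₀ + K'p` of the row `N = N₀ + (m+1)p` of the kernel `ε` (`ε₁ = (N₀+K₀)/p`,
`ε₂ = (N₀+(N₀+p−K₀))/p`, `c_c = [p ∣ N − 2K]`, `y_c = (N/2 − K)/p`). -/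
def classPoly (B ε p N₀ m K₀ K' : ℕ) : ℚ[X] :=
  (X + C (-((K' : ℚ) + ((m + 1 + 1 : ℕ) : ℚ)))) ^ (B * ((N₀ + K₀) / p)) *
    (X + C ((m : ℚ) + ((m + 1 + 1 : ℕ) : ℚ) - K')) ^ (B * ((N₀ + (N₀ + p - K₀)) / p)) *
    (X + C (((((N₀ + (m + 1) * p : ℕ) : ℚ)) / 2 - ((K₀ + K' * p : ℕ) : ℚ)) / p)) ^
      (ε * centreCarry p (N₀ + (m + 1) * p) (K₀ + K' * p))

/-- **The hole factor** `holePoly = Ê_{K'}·Q^{cl}`: `F^{cl}_{K'} = n^{A−2B}·holePoly·F̃_{K'}^{(m)}` is the Laurent series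
at `−K'` of zi-p2's class kernel `K^{cl}_n = Q^{cl}·R̂_n`. -/
def holePoly (B ε p N₀ m K₀ K' : ℕ) : ℚ[X] := hatPoly B m K' * classPoly B ε p N₀ m K₀ K'

/-- `Q^{cl} ∈ ℤ_(p)[X]` coefficientwise (odd `p`). -/
theorem isSlopeInt_classPoly (hp2 : p ≠ 2) (B ε N₀ m K₀ K' : ℕ) :
    IsSlopeInt p 0 0 ((classPoly B ε p N₀ m K₀ K' : ℚ[X]) : PowerSeries ℚ) := by
  unfold classPoly
  rw [Polynomial.coe_mul, Polynomial.coe_mul, Polynomial.coe_pow, Polynomial.coe_pow, Polynomial.coe_pow]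
  have ha : IsSlopeInt p 0 0 (((X + C (-((K' : ℚ) + ((m + 1 + 1 : ℕ) : ℚ))) : ℚ[X]) : PowerSeries ℚ)) := by
    refine isSlopeInt_X_add_C ?_
    rw [Valuation.map_neg, ← Nat.cast_add]; exact padicValuation_natCast_le_one _
  have hb : IsSlopeInt p 0 0 (((X + C ((m : ℚ) + ((m + 1 + 1 : ℕ) : ℚ) - K')) : ℚ[X]) : PowerSeries ℚ) := by
    refine isSlopeInt_X_add_C ?_
    rw [show (m : ℚ) + ((m + 1 + 1 : ℕ) : ℚ) - K' = (((m : ℤ) + (m + 1 + 1 : ℕ) - K' : ℤ) : ℚ) by push_cast; ring,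
      Rat.padicValuation_cast]
    exact Int.padicValuation_le_one _ _
  set Yc : PowerSeries ℚ :=
    (((X + C (((((N₀ + (m + 1) * p : ℕ) : ℚ)) / 2 - ((K₀ + K' * p : ℕ) : ℚ)) / p)) : ℚ[X]) : PowerSeries ℚ) with hYc
  have hc : IsSlopeInt p 0 0 (Yc ^ (ε * centreCarry p (N₀ + (m + 1) * p) (K₀ + K' * p))) := by
    unfold centreCarry
    split_ifs with h
    · exact isSlopeInt_pow (isSlopeInt_X_add_C (padicValuation_centre_le (p := p) hp2 h)) _
    · rw [mul_zero, pow_zero]; exact isSlopeInt_one 0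
  have h := isSlopeInt_mul (isSlopeInt_mul (isSlopeInt_pow ha (B * ((N₀ + K₀) / p)))
    (isSlopeInt_pow hb (B * ((N₀ + (N₀ + p - K₀)) / p)))) hc
  simpa using h

/-- `holePoly ∈ ℤ_(p)[X]` coefficientwise (odd `p`). -/
theorem isSlopeInt_holePoly (hp2 : p ≠ 2) (B ε N₀ m K₀ K' : ℕ) :
    IsSlopeInt p 0 0 ((holePoly B ε p N₀ m K₀ K' : ℚ[X]) : PowerSeries ℚ) := by
  unfold holePoly
  rw [Polynomial.coe_mul]
  have h := isSlopeInt_mul (isSlopeInt_hatPoly (p := p) B m K') (isSlopeInt_classPoly hp2 B ε N₀ m K₀ K')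
  simpa using h

/-- The coefficients of `holePoly` are `p`-integral: `v([X^h]holePoly) ≤ 1`. -/
theorem padicValuation_holePoly_coeff_le (hp2 : p ≠ 2) (B ε N₀ m K₀ K' h : ℕ) :
    Rat.padicValuation p ((holePoly B ε p N₀ m K₀ K').coeff h) ≤ 1 := by
  have := isSlopeInt_holePoly hp2 B ε N₀ m K₀ K' h
  rwa [zero_mul, zero_add, exp_zero, Polynomial.coeff_coe] at this

/-! ## The assembled identity -/

section hole

variable (hp2 : p ≠ 2) {A B ε N₀ K₀ m K' : ℕ} (hNK : N₀ < K₀) (hK₀ : K₀ < p) (hK' : K' ≤ m)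
include hp2 hNK hK₀ hK'

/-- NUMERATOR of a hole cell: `taylor_{−K}(kerNum^{ε}_N)(pX) = C(a)·taylor_{−K'}(kerNum^{0}_m)·holePoly·V`, `V` unit,
`a ≠ 0`. -/
theorem num_comp_eq_hole :
    ∃ V : ℚ[X], IsUnitPoly p V ∧ ∃ a : ℚ, a ≠ 0 ∧
      (taylor (-((K₀ + K' * p : ℕ) : ℚ)) (kerNum A B ε (N₀ + (m + 1) * p))).comp (C (p : ℚ) * X) =
        C a * taylor (-(K' : ℚ)) (kerNum A B 0 m) * holePoly B ε p N₀ m K₀ K' * V := by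
  have hp : p.Prime := Fact.out
  obtain ⟨Vc, hVc, cc, hcc, hceq⟩ := centre_factor_circ (p := p) hp2 ε (N₀ + (m + 1) * p) (K₀ + K' * p)
  obtain ⟨V₁, hV₁, c₁, hc₁, h₁⟩ := num_family_one_hole (p := p) (m := m) (K' := K') hNK hK₀
  obtain ⟨V₂, hV₂, c₂, hc₂, h₂⟩ := num_family_two_hole (p := p) hNK hK₀ hK'
  obtain ⟨he₁, he₂⟩ := hole_carry_le_one (p := p) hNK hK₀
  rw [prod_Icc_add_of_le_one _ (m + 1) he₁, Finset.prod_Icc_succ_top (by omega : 1 ≤ m + 1)] at h₁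
  rw [prod_Icc_add_of_le_one _ (m + 1) he₂, Finset.prod_Icc_succ_top (by omega : 1 ≤ m + 1)] at h₂
  obtain ⟨Ya, hYa⟩ : ∃ Y : ℚ[X], (X + C (-((K' : ℚ) + ((m + 1 : ℕ) : ℚ))) : ℚ[X]) = Y := ⟨_, rfl⟩
  obtain ⟨Yb, hYb⟩ : ∃ Y : ℚ[X], (X + C ((m : ℚ) + ((m + 1 : ℕ) : ℚ) - K') : ℚ[X]) = Y := ⟨_, rfl⟩
  obtain ⟨Za, hZa⟩ : ∃ Y : ℚ[X], (X + C (-((K' : ℚ) + ((m + 1 + 1 : ℕ) : ℚ))) : ℚ[X]) = Y := ⟨_, rfl⟩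
  obtain ⟨Zb, hZb⟩ : ∃ Y : ℚ[X], (X + C ((m : ℚ) + ((m + 1 + 1 : ℕ) : ℚ) - K') : ℚ[X]) = Y := ⟨_, rfl⟩
  rw [hYa, hZa] at h₁
  rw [hYb, hZb] at h₂
  set P₁ : ℚ[X] := ∏ t ∈ Icc 1 m, (X + C (-((K' : ℚ) + t))) with hP₁
  set P₂ : ℚ[X] := ∏ t ∈ Icc 1 m, (X + C ((m : ℚ) + t - K')) with hP₂
  set Yc : ℚ[X] := X + C (((((N₀ + (m + 1) * p : ℕ) : ℚ)) / 2 - ((K₀ + K' * p : ℕ) : ℚ)) / p) with hYc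
  have hNf : ((m ! : ℚ)) ^ (A - 2 * B) ≠ 0 := pow_ne_zero _ (by positivity)
  have hnf : (((N₀ + (m + 1) * p)! : ℚ)) ^ (A - 2 * B) ≠ 0 := pow_ne_zero _ (by positivity)
  set a : ℚ := (((N₀ + (m + 1) * p)! : ℚ)) ^ (A - 2 * B) * cc * c₁ ^ B * c₂ ^ B / ((m ! : ℚ)) ^ (A - 2 * B) with ha
  have key : C ((((N₀ + (m + 1) * p)! : ℚ)) ^ (A - 2 * B)) * C cc * C c₁ ^ B * C c₂ ^ B =
      C a * C (((m ! : ℚ)) ^ (A - 2 * B)) := by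
    rw [← map_pow, ← map_pow, ← map_mul, ← map_mul, ← map_mul, ← map_mul, ha, div_mul_cancel₀ _ hNf]
  refine ⟨Vc * (V₁ ^ B * V₂ ^ B), hVc.mul ((hV₁.pow B).mul (hV₂.pow B)), a,
    div_ne_zero (mul_ne_zero (mul_ne_zero (mul_ne_zero hnf hcc) (pow_ne_zero _ hc₁)) (pow_ne_zero _ hc₂)) hNf, ?_⟩
  rw [taylor_kerNum, taylor_kerNum]
  simp only [mul_comp, pow_comp, Polynomial.prod_comp, add_comp, X_comp, C_comp]
  rw [hceq, h₁, h₂, pow_zero, mul_one]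
  unfold holePoly hatPoly classPoly
  rw [hYa, hYb, hZa, hZb, pow_mul' Za B ((N₀ + K₀) / p), pow_mul' Zb B ((N₀ + (N₀ + p - K₀)) / p)]
  linear_combination (Vc * V₁ ^ B * V₂ ^ B * P₁ ^ B * P₂ ^ B * Ya ^ B * Yb ^ B * (Za ^ ((N₀ + K₀) / p)) ^ B *
    (Zb ^ ((N₀ + (N₀ + p - K₀)) / p)) ^ B * Yc ^ (ε * centreCarry p (N₀ + (m + 1) * p) (K₀ + K' * p))) * key

/-- **THEOREM 10 (i), HOLE = HAT** (zi-p2 LEMMA 10.1): for the hole cell `K = K₀ + K'p` (`N₀ < K₀ < p`, `K' ≤ m`) of the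
row `N = N₀ + (m+1)p` of the kernel `ε` (odd `p`): `rescale_p(F_K^{(N)}) = C(a)·F̃_{K'}^{(m)}·holePoly·U` with `U(0) = 1`,
`[T^g]U ∈ p^gℤ_(p)`, and `a·holePoly(0)·c̃_{K',A}(m) = c_{K,A}(N)`. -/
theorem laurentSeries_rescale_eq_hole :
    ∃ U : PowerSeries ℚ, PowerSeries.constantCoeff U = 1 ∧ IsSlopeInt p (-1) 0 U ∧ ∃ a : ℚ,
      PowerSeries.rescale (p : ℚ) (laurentSeries A B ε (N₀ + (m + 1) * p) (K₀ + K' * p)) =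
        PowerSeries.C a * laurentSeries A B 0 m K' * ((holePoly B ε p N₀ m K₀ K' : ℚ[X]) : PowerSeries ℚ) * U ∧
      a * (holePoly B ε p N₀ m K₀ K').eval 0 * laurent A B 0 m K' 0 =
        laurent A B ε (N₀ + (m + 1) * p) (K₀ + K' * p) 0 := by
  obtain ⟨V₁, hV₁, a, ha, hN⟩ := num_comp_eq_hole (p := p) hp2 (A := A) (B := B) (ε := ε) hNK hK₀ hK'
  obtain ⟨V₂, hV₂, b, hb, hD⟩ := den_family_hole (p := p) (m := m) (K' := K') hNK hK₀
  have hD' : (taylor (-((K₀ + K' * p : ℕ) : ℚ)) (kerDenErase A (N₀ + (m + 1) * p) (K₀ + K' * p))).comp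
      (C (p : ℚ) * X) = C (b ^ A) * taylor (-(K' : ℚ)) (kerDenErase A m K') * V₂ ^ A := by
    rw [taylor_kerDenErase, taylor_kerDenErase, pow_comp, Polynomial.prod_comp]
    simp only [add_comp, X_comp, C_comp]
    rw [hD, mul_pow, mul_pow, map_pow]
  have hV₁0 : PowerSeries.constantCoeff (V₁ : PowerSeries ℚ) = 1 := by
    rw [Polynomial.constantCoeff_coe, coeff_zero_eq_eval_zero, hV₁.1]
  have hV₂0 : PowerSeries.constantCoeff ((V₂ ^ A : ℚ[X]) : PowerSeries ℚ) = 1 := by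
    rw [Polynomial.constantCoeff_coe, coeff_zero_eq_eval_zero, (hV₂.pow A).1]
  have hU0 : PowerSeries.constantCoeff ((V₁ : PowerSeries ℚ) * (((V₂ ^ A : ℚ[X]) : PowerSeries ℚ))⁻¹) = 1 := by
    rw [map_mul, PowerSeries.constantCoeff_inv, hV₁0, hV₂0, inv_one, mul_one]
  have hUint : IsSlopeInt p (-1) 0 ((V₁ : PowerSeries ℚ) * (((V₂ ^ A : ℚ[X]) : PowerSeries ℚ))⁻¹) := by
    have h := isSlopeInt_mul hV₁.2 (isSlopeInt_inv (hV₂.pow A).2 (by rw [hV₂0, map_one]))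
    rwa [add_zero] at h
  have hbA : b ^ A ≠ 0 := pow_ne_zero _ hb
  have hid : PowerSeries.rescale (p : ℚ) (laurentSeries A B ε (N₀ + (m + 1) * p) (K₀ + K' * p)) =
      PowerSeries.C (a / b ^ A) * laurentSeries A B 0 m K' * ((holePoly B ε p N₀ m K₀ K' : ℚ[X]) : PowerSeries ℚ) *
        ((V₁ : PowerSeries ℚ) * (((V₂ ^ A : ℚ[X]) : PowerSeries ℚ))⁻¹) := by
    have hL : PowerSeries.rescale (p : ℚ) (laurentSeries A B ε (N₀ + (m + 1) * p) (K₀ + K' * p)) =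
        (((taylor (-((K₀ + K' * p : ℕ) : ℚ)) (kerNum A B ε (N₀ + (m + 1) * p))).comp (C (p : ℚ) * X) : ℚ[X]) :
          PowerSeries ℚ) *
        ((((taylor (-((K₀ + K' * p : ℕ) : ℚ)) (kerDenErase A (N₀ + (m + 1) * p) (K₀ + K' * p))).comp
          (C (p : ℚ) * X) : ℚ[X]) : PowerSeries ℚ))⁻¹ := by
      rw [laurentSeries, expandAt, map_mul, rescale_inv _ (by
        rw [constantCoeff_coe_taylor]; exact eval_kerDenErase_neg_ne_zero _ _ _), coe_comp_C_mul_X, coe_comp_C_mul_X]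
    rw [hL, hN, hD', laurentSeries, expandAt]
    simp only [Polynomial.coe_mul, Polynomial.coe_C, PowerSeries.mul_inv_rev, PowerSeries.C_inv]
    rw [div_eq_mul_inv, map_mul]
    ring
  refine ⟨_, hU0, hUint, a / b ^ A, hid, ?_⟩
  have h0 := congrArg (PowerSeries.coeff 0) hid
  rw [PowerSeries.coeff_rescale, pow_zero, one_mul, mul_assoc, mul_assoc, PowerSeries.coeff_C_mul,
    PowerSeries.coeff_zero_eq_constantCoeff_apply (laurentSeries A B 0 m K' * _), map_mul, map_mul, hU0, mul_one,
    Polynomial.constantCoeff_coe, coeff_zero_eq_eval_zero, ← PowerSeries.coeff_zero_eq_constantCoeff_apply] at h0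
  rw [laurent, laurent, h0]
  ring

end hole

end

end Summit.KontsevichZagierPeriods.Zeta5Search.BrickHoleStrip
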